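import Summits.QuantumFields.BalabanUV.Beta.EriceRemainderEnclosureHistoryAutonomyComparisonAgeCompositionChainShares
import Literature.Dynamics.Contraction.ComplexConeContractionLemma22

/-!
# EriceRemainderEnclosureHistoryAutonomyComparisonAgeCompositionAgeRatioWindow — (E112a) route (N), first order: THE MASS ROUTE IS SCALE-FREE —
# EVERY PROFILE WHOSE AGES LIE IN A WINDOW `[k₀, 53·k₀]` (ANY `k₀ ≥ 1`, ANY NUMBER OF AGES, ANY DISTRIBUTION OF THE LOAD) HAS TOTAL WINDOW LOAD
# `Σ_k k·L_kh(m+k)³∕2 ≤ 1` AT EVERY PIN ALONG EVERY ADMISSIBLE FLOW — HENCE THE END `0 ≤ ε ≤ e` (ANY DAMPING IN `]0,1]`, ANY HORIZON).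
# (E90d) `total_load_le_one_of_range` is the case `k₀ = 1` (there: ages `≤ 52`; here `≤ 53`): its integer chain `ρ_t⁴ = (t+2)∕(t+3)` is replaced by the
# chain ADAPTED TO THE YOUNGEST AGE, `σ_t⁴ = (2k₀+t)∕(2k₀+t+1)` between the ages `k₀+t` and `k₀+t+1` — still below the correlations, because the slack in
# (E90d) `chain_kernel_le` is `(k−1)(l−k) ≥ 0` and becomes `(k−k₀)(l−k) ≥ 0` (`chain_kernel_le_from`) — and its block numerics `chain_numerics` (seven
# harmonic blocks, `n ≤ 51`) by ONE LOGARITHM: `(1−σ)∕(1+σ) ≤ ½·log(1∕σ)` (`share_defect_le_half_log`, from the tree's `2(r−1)∕(r+1) ≤ log r`,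
# `Literature.Dynamics.Contraction.two_mul_sub_one_div_add_one_le_log` — the logarithmic mean lies below the arithmetic mean) makes the chain sum TELESCOPE, `Σ_{t<n} (1−σ_t)∕(1+σ_t) ≤ ⅛·log((2k₀+n)∕(2k₀))` (`sum_defect_le_log`), so the share
# functional is `≤ 1 + ⅛·log((k₀+k_max)∕(2k₀)) ≤ 1 + ⅛·log 27 ≤ √2` as soon as `k_max ≤ 53·k₀` (`chain_const_le_sqrt_two`: `log 27 ≤ 3.31`,
# `1 + 3.31∕8 ≤ √2`).  The range theorem of (E90d) was the only mass statement of the census that did not scale with the youngest age; this one does: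
# dense clusters `[a, 53a]`, towers `{a, 2a, 4a, 8a, 16a, 32a}`, `{a, 3a, 9a, 27a}`, … for EVERY `a` — the part of README `HOME/b2b-balaban-beta-d4-p2/g92/
# README.md` §6 «OPEN: consecutive ratios in (1,9) beyond three ages» whose total span is at most `53`.

Cell `pub-balaban`, β-function sub-cell, BINDER row D4 «RemainderConst leaves for Bałaban's split» (`HOME/BINDER-OWNERS.md`; owner lineage `b2b-balaban-beta-an4`;
this file by co-owner #2 lineage `b2b-balaban-beta-d4-p2`, generation 93), β-FLOW TEAM duty (1), FREEZE (0) honoured (def-free; imports (E90d) `…ChainShares`;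
and `Literature.Dynamics.Contraction.ComplexConeContractionLemma22` (for the elementary `two_mul_sub_one_div_add_one_le_log` only); uses (E90d)
`chain_shares_le`, (E90b) `load_le_share` ∕ `mul_sq_le_from_pin`, (E89b) `flow_nonneg_of_window_loads_le_one`, (E48a) `strictAnti_of_memFlow` BY NAME;
nothing restated).

HONEST FRAMING (page 1, verbatim and binding).  *"Discharging BetaPertH makes Bałaban's UV stability UNCONDITIONAL — a real constructive-QFT result; it is
NOT the continuum limit and NOT the Clay problem."*  THIS FILE DISCHARGES NOTHING OF THE KIND.  Elementary real analysis about ABSTRACT functionals on a box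
]0,γ]^ℕ with displayed floors, profiles and signs, and the FIRST-ORDER renewal objects of route (N) built from them — hypotheses of a census, not facts; the
form, signs, ages and moments of Bałaban's (1.22) limit functional are NOT PRINTED ([I] p. 298; GAPS G-t4-U2-1∕-2) and NOT asserted.  Row D4 class
UNCHANGED (critical-path width 0; instance 0∕1; D4 DISCHARGE NO DATE).  HONEST DEPENDENCY: continuum YM on T⁴ ⇐ BetaPertH ∧ nine spine estimates (0/9
proved); BetaPertH ⇐ (D1) ∧ (D4) ∧ CAP+tail; G-an2-4 gates asym, D1 and NE2/3/4.

THE POINT (README `HOME/b2b-balaban-beta-d4-p2/g93/README.md` §1–§2).  (E90d)'s chain bound `1 + Σ_t (1−ρ_t)∕(1+ρ_t)` grows like `⅛·log` of the RATIO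
of the extreme chain parameters, not like the number of links: with `f(ρ) = tanh(½·log(1∕ρ)) ≤ ½·log(1∕ρ)` the sum telescopes to `⅛·log(Πρ_t⁻⁴)`.  For a
profile supported on `[k₀, K)` the admissible telescoping chain is `φ(k) = k + k₀` (`φ(k)∕φ(l) ≤ 2k∕(k+l) ≤ C_kl⁴` for `k₀ ≤ k ≤ l` ⟺ `(k−k₀)(k−l) ≤ 0`),
whose total product is `2k₀∕(k₀+k_max)`; so `T ≤ (√2∕2)(1 + ⅛·log((k₀+k_max)∕(2k₀))) ≤ 1` iff `(k₀+k_max)∕(2k₀) ≤ e^{8(√2−1)} = 27.48…`, i.e. `k_max ≤ 53.97·k₀`;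
typed with `k_max ≤ 53·k₀`.  NOT CLAIMED: spans beyond `53·k₀` (the measured truth: `T ≤ 1` to span ≈ 5·10³ and `T → 1.35`, README g82 §3; the share
relaxation itself crosses `√2` near span 150, README g92 §5); anything printed — NOT B12 Thm 2, NOT BetaPertH, NOT continuum, NOT Clay.

WHAT IS PROVED ([folklore]; 0 `def`, 0 sorry).  §1 **`share_defect_le_half_log`**, `sigma_facts`,
`defect_sigma_le`, **`sum_defect_le_log`**, `prod_sigma_telescope`.  §2 `exp_331_ge`, **`chain_const_le_sqrt_two`**.  §3 **`chain_kernel_le_from`**,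
`load_le_chain_share_from`, **`total_load_le_one_of_age_ratio`**, **`flow_nonneg_of_age_ratio`**.
-/
noncomputable section
open Finset

namespace Summit.QuantumFields.BalabanUV.Beta.EriceRemainderEnclosureHistoryAutonomyComparisonAgeCompositionAgeRatioWindow

open Literature.MathematicalPhysics.QuantumFieldTheory.Balaban1983to89
open Literature.MathematicalPhysics.QuantumFieldTheory.Balaban1983to89.T4BetaStationary
open Literature.MathematicalPhysics.QuantumFieldTheory.Balaban1983to89.T4BetaFlowWellPosed
open Summit.QuantumFields.BalabanUV.Beta.EriceRemainderEnclosureHistoryAutonomyOrder (strictAnti_of_memFlow)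
open Summit.QuantumFields.BalabanUV.Beta.EriceRemainderEnclosureHistoryAutonomyComparisonAgeCompositionThreeAgesMassCap (flow_nonneg_of_window_loads_le_one)
open Summit.QuantumFields.BalabanUV.Beta.EriceRemainderEnclosureHistoryAutonomyComparisonAgeCompositionWindowShares (mul_sq_le_from_pin load_le_share)
open Summit.QuantumFields.BalabanUV.Beta.EriceRemainderEnclosureHistoryAutonomyComparisonAgeCompositionChainShares (chain_shares_le)
open Literature.Dynamics.Contraction (two_mul_sub_one_div_add_one_le_log)

variable {B : (ℕ → ℝ) → ℝ} {γ b gIR : ℝ} {L : ℕ → ℝ} {K : ℕ} {h g : ℕ → ℝ}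

/-! ## §1 The logarithmic defect bound; the chain adapted to the youngest age telescopes -/

/-- **THE SHARE DEFECT IS BELOW HALF THE LOGARITHM**: `(1−ρ)∕(1+ρ) ≤ ½·log(1∕ρ)` for `0 < ρ ≤ 1` (`= tanh(½·log(1∕ρ)) ≤ ½·log(1∕ρ)`; at `r = 1∕ρ` this is
the tree's `Literature.Dynamics.Contraction.two_mul_sub_one_div_add_one_le_log`, `2(r−1)∕(r+1) ≤ log r`). [folklore] -/
theorem share_defect_le_half_log {ρ : ℝ} (hρ0 : 0 < ρ) (hρ1 : ρ ≤ 1) : (1 - ρ) / (1 + ρ) ≤ Real.log (1 / ρ) / 2 := by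
  have hx : (1 : ℝ) ≤ 1 / ρ := by rw [le_div_iff₀ hρ0]; linarith
  have h := two_mul_sub_one_div_add_one_le_log hx
  have e : 2 * (1 / ρ - 1) / (1 / ρ + 1) = 2 * ((1 - ρ) / (1 + ρ)) := by
    have hρ : ρ ≠ 0 := hρ0.ne'
    have h1 : (1 : ℝ) + ρ ≠ 0 := by linarith
    rw [div_sub_one hρ, div_add_one hρ, mul_div_assoc, div_div_div_cancel_right₀ hρ]
  rw [e] at h
  linarith

/-- The chain parameter adapted to the youngest age `k₀ ≥ 1`: `σ_t = √√((2k₀+t)∕(2k₀+t+1)) ∈ ]0,1[` and `σ_t⁴ = (2k₀+t)∕(2k₀+t+1)`. [folklore] -/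
theorem sigma_facts {k₀ : ℕ} (hk₀ : 1 ≤ k₀) (t : ℕ) :
    0 < Real.sqrt (Real.sqrt ((2 * (k₀ : ℝ) + t) / (2 * (k₀ : ℝ) + t + 1)))
      ∧ Real.sqrt (Real.sqrt ((2 * (k₀ : ℝ) + t) / (2 * (k₀ : ℝ) + t + 1))) < 1
      ∧ Real.sqrt (Real.sqrt ((2 * (k₀ : ℝ) + t) / (2 * (k₀ : ℝ) + t + 1))) ^ 4 = (2 * (k₀ : ℝ) + t) / (2 * (k₀ : ℝ) + t + 1) := by
  have hk : (1 : ℝ) ≤ k₀ := by exact_mod_cast hk₀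
  have hq0 : 0 < (2 * (k₀ : ℝ) + t) / (2 * (k₀ : ℝ) + t + 1) := by positivity
  have hq1 : (2 * (k₀ : ℝ) + t) / (2 * (k₀ : ℝ) + t + 1) < 1 := by rw [div_lt_one (by positivity)]; linarith
  refine ⟨Real.sqrt_pos.2 (Real.sqrt_pos.2 hq0), ?_, ?_⟩
  · rw [Real.sqrt_lt' one_pos, one_pow, Real.sqrt_lt' one_pos, one_pow]; exact hq1
  · rw [show (4 : ℕ) = 2 * 2 by norm_num, pow_mul, Real.sq_sqrt (Real.sqrt_nonneg _), Real.sq_sqrt hq0.le]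

/-- One link of the adapted chain costs at most `⅛·(log(2k₀+t+1) − log(2k₀+t))`. [folklore] -/
theorem defect_sigma_le {k₀ : ℕ} (hk₀ : 1 ≤ k₀) (t : ℕ) :
    (1 - Real.sqrt (Real.sqrt ((2 * (k₀ : ℝ) + t) / (2 * (k₀ : ℝ) + t + 1)))) / (1 + Real.sqrt (Real.sqrt ((2 * (k₀ : ℝ) + t) / (2 * (k₀ : ℝ) + t + 1))))
      ≤ (Real.log (2 * (k₀ : ℝ) + t + 1) - Real.log (2 * (k₀ : ℝ) + t)) / 8 := by
  obtain ⟨hs0, hs1, hs4⟩ := sigma_facts hk₀ t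
  set s := Real.sqrt (Real.sqrt ((2 * (k₀ : ℝ) + t) / (2 * (k₀ : ℝ) + t + 1))) with hs
  have hk : (1 : ℝ) ≤ k₀ := by exact_mod_cast hk₀
  have hA : 0 < 2 * (k₀ : ℝ) + t := by positivity
  have hA1 : 0 < 2 * (k₀ : ℝ) + t + 1 := by positivity
  have h1 := share_defect_le_half_log hs0 hs1.le
  -- log(1/s) = ¼·log(1/s⁴) = ¼·(log(A+1) − log A)
  have hlog : Real.log (1 / s) = (Real.log (2 * (k₀ : ℝ) + t + 1) - Real.log (2 * (k₀ : ℝ) + t)) / 4 := by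
    have e4 : Real.log (1 / s) * 4 = Real.log ((1 / s) ^ 4) := by rw [Real.log_pow]; push_cast; ring
    have e5 : (1 / s) ^ 4 = (2 * (k₀ : ℝ) + t + 1) / (2 * (k₀ : ℝ) + t) := by
      rw [div_pow, one_pow, hs4, one_div_div]
    rw [eq_div_iff (by norm_num : (4 : ℝ) ≠ 0), e4, e5, Real.log_div hA1.ne' hA.ne']
  rw [hlog] at h1
  linarith

/-- **THE ADAPTED CHAIN TELESCOPES**: `Σ_{t<n} (1−σ_t)∕(1+σ_t) ≤ ⅛·(log(2k₀+n) − log(2k₀))`. [folklore] -/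
theorem sum_defect_le_log {k₀ : ℕ} (hk₀ : 1 ≤ k₀) (n : ℕ) :
    ∑ t ∈ range n, (1 - Real.sqrt (Real.sqrt ((2 * (k₀ : ℝ) + t) / (2 * (k₀ : ℝ) + t + 1))))
        / (1 + Real.sqrt (Real.sqrt ((2 * (k₀ : ℝ) + t) / (2 * (k₀ : ℝ) + t + 1))))
      ≤ (Real.log (2 * (k₀ : ℝ) + n) - Real.log (2 * (k₀ : ℝ))) / 8 := by
  have htel : ∑ t ∈ range n, (Real.log (2 * (k₀ : ℝ) + t + 1) - Real.log (2 * (k₀ : ℝ) + t)) / 8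
      = (Real.log (2 * (k₀ : ℝ) + n) - Real.log (2 * (k₀ : ℝ))) / 8 := by
    rw [← sum_div]
    congr 1
    have := sum_range_sub (fun t => Real.log (2 * (k₀ : ℝ) + t)) n
    simp only [Nat.cast_add, Nat.cast_one, Nat.cast_zero, add_zero] at this
    rw [← this]
    exact sum_congr rfl fun t _ => by rw [add_assoc]
  rw [← htel]
  exact sum_le_sum fun t _ => defect_sigma_le hk₀ t

/-- The fourth powers of the adapted chain telescope: `Π_{t∈[i,j)} (2k₀+t)∕(2k₀+t+1) = (2k₀+i)∕(2k₀+j)`. [folklore] -/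
theorem prod_sigma_telescope {k₀ : ℕ} (hk₀ : 1 ≤ k₀) {i j : ℕ} (hij : i ≤ j) :
    ∏ t ∈ Ico i j, ((2 * (k₀ : ℝ) + t) / (2 * (k₀ : ℝ) + t + 1)) = (2 * (k₀ : ℝ) + i) / (2 * (k₀ : ℝ) + j) := by
  have hk : (1 : ℝ) ≤ k₀ := by exact_mod_cast hk₀
  induction j, hij using Nat.le_induction with
  | base => rw [Ico_self, prod_empty, div_self (by positivity)]
  | succ j hij ih =>
    rw [prod_Ico_succ_top hij, ih, div_mul_div_comm, div_eq_div_iff (by positivity) (by positivity)]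
    push_cast; ring

/-! ## §2 Numerics: `log 27 ≤ 3.31` and `1 + 3.31∕8 ≤ √2` -/

/-- `27 ≤ e^{3.31}` (`e ≥ 2.7182818283`, `e^{0.31} ≥ 1 + 0.31 + 0.31²∕2`). [folklore] -/
theorem exp_331_ge : (27 : ℝ) ≤ Real.exp (331 / 100) := by
  have h1 := Real.exp_one_gt_d9
  have h3 : Real.exp 3 = Real.exp 1 ^ 3 := by rw [← Real.exp_nat_mul]; norm_num
  have hq := Real.quadratic_le_exp_of_nonneg (show (0 : ℝ) ≤ 31 / 100 by norm_num)
  rw [show (331 : ℝ) / 100 = 3 + 31 / 100 by norm_num, Real.exp_add, h3]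
  have he3 : (2.7182818283 : ℝ) ^ 3 ≤ Real.exp 1 ^ 3 := pow_le_pow_left₀ (by norm_num) h1.le 3
  have key := mul_le_mul he3 hq (by norm_num) (pow_nonneg (Real.exp_pos 1).le 3)
  have h27 : (27 : ℝ) ≤ (2.7182818283 : ℝ) ^ 3 * (1 + 31 / 100 + (31 / 100) ^ 2 / 2) := by norm_num
  linarith

/-- **THE CHAIN CONSTANT**: `0 < x ≤ 27 ⟹ 1 + ⅛·log x ≤ √2` (`log 27 ≤ 3.31`, `(1 + 3.31∕8)² ≤ 2`). [folklore] -/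
theorem chain_const_le_sqrt_two {x : ℝ} (hx0 : 0 < x) (hx : x ≤ 27) : 1 + Real.log x / 8 ≤ Real.sqrt 2 := by
  have hlog : Real.log x ≤ 331 / 100 := by
    rw [Real.log_le_iff_le_exp hx0]
    exact hx.trans exp_331_ge
  have hs : (1 : ℝ) + 331 / 100 / 8 ≤ Real.sqrt 2 := by
    rw [Real.le_sqrt (by norm_num)] <;> norm_num
  linarith

/-! ## §3 Along the flow: the adapted chain lies below the correlations; the scale-free mass theorem; the END -/

/-- **THE ADAPTED CHAIN LIES BELOW THE CORRELATIONS**: for `k₀ ≥ 1` and positions `i ≤ j` (ages `k₀+i ≤ k₀+j`) along every flow,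
`(Π_{t∈[i,j)} σ_t)·√(h(m+2(k₀+i)))·√(h(m+2(k₀+j))) ≤ h(m+(k₀+i)+(k₀+j))` — fourth powers: `((2k₀+i)∕(2k₀+j))·h(m+2k)²h(m+2l)² ≤ h(m+k+l)⁴` by concavity
from the pin (`2k·h(m+2k)² ≤ (k+l)·h(m+k+l)²`), antitonicity, and the slack `i(j−i) ≥ 0` (= `(k−k₀)(l−k)`). [folklore] -/
theorem chain_kernel_le_from (hmono : ∀ u v : ℕ → ℝ, SeqBox γ u → SeqBox γ v → (∀ j, u j ≤ v j) → B u ≤ B v) (hb : 0 < b)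
    (hlo : ∀ u, SeqBox γ u → b ≤ B u) (hh : SeqBox γ h) (hf : MemFlow B gIR h) {k₀ : ℕ} (hk₀ : 1 ≤ k₀) (m : ℕ) {i j : ℕ} (hij : i ≤ j) :
    (∏ t ∈ Ico i j, Real.sqrt (Real.sqrt ((2 * (k₀ : ℝ) + t) / (2 * (k₀ : ℝ) + t + 1))))
        * (Real.sqrt (h (m + 2 * (k₀ + i))) * Real.sqrt (h (m + 2 * (k₀ + j))))
      ≤ h (m + (k₀ + i) + (k₀ + j)) := by
  have hpos : ∀ n, 0 < h n := fun n => (hh n).1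
  have hk : (1 : ℝ) ≤ k₀ := by exact_mod_cast hk₀
  have hanti := (strictAnti_of_memFlow hb hlo hh hf).antitone
  have hP0 : 0 ≤ ∏ t ∈ Ico i j, Real.sqrt (Real.sqrt ((2 * (k₀ : ℝ) + t) / (2 * (k₀ : ℝ) + t + 1))) :=
    prod_nonneg fun t _ => Real.sqrt_nonneg _
  have hP4 : (∏ t ∈ Ico i j, Real.sqrt (Real.sqrt ((2 * (k₀ : ℝ) + t) / (2 * (k₀ : ℝ) + t + 1)))) ^ 4 = (2 * (k₀ : ℝ) + i) / (2 * (k₀ : ℝ) + j) := by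
    rw [← prod_pow, prod_congr rfl fun t _ => (sigma_facts hk₀ t).2.2, prod_sigma_telescope hk₀ hij]
  have hi2 := hpos (m + 2 * (k₀ + i)); have hj2 := hpos (m + 2 * (k₀ + j)); have hij2 := hpos (m + (k₀ + i) + (k₀ + j))
  have hs4 : (Real.sqrt (h (m + 2 * (k₀ + i))) * Real.sqrt (h (m + 2 * (k₀ + j)))) ^ 4 = h (m + 2 * (k₀ + i)) ^ 2 * h (m + 2 * (k₀ + j)) ^ 2 := by
    rw [mul_pow, show (4 : ℕ) = 2 * 2 by norm_num, pow_mul, pow_mul, Real.sq_sqrt hi2.le, Real.sq_sqrt hj2.le]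
  -- concavity from the pin: 2k·h(m+2k)² ≤ (2k+(j−i))·h(m+2k+(j−i))², 2k+(j−i) = k+l
  have hc := mul_sq_le_from_pin hmono hb hlo hh hf m (2 * (k₀ + i)) (j - i)
  rw [show m + 2 * (k₀ + i) + (j - i) = m + (k₀ + i) + (k₀ + j) by omega, Nat.cast_sub hij] at hc
  push_cast at hc
  have ha : h (m + 2 * (k₀ + j)) ^ 2 ≤ h (m + (k₀ + i) + (k₀ + j)) ^ 2 := pow_le_pow_left₀ (hpos _).le (hanti (by omega)) 2
  have hijR : (i : ℝ) ≤ j := by exact_mod_cast hij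
  have h4 : ((∏ t ∈ Ico i j, Real.sqrt (Real.sqrt ((2 * (k₀ : ℝ) + t) / (2 * (k₀ : ℝ) + t + 1))))
        * (Real.sqrt (h (m + 2 * (k₀ + i))) * Real.sqrt (h (m + 2 * (k₀ + j))))) ^ 4 ≤ h (m + (k₀ + i) + (k₀ + j)) ^ 4 := by
    rw [mul_pow, hP4, hs4, div_mul_eq_mul_div, div_le_iff₀ (by positivity)]
    -- (2k₀+i)·h(m+2k)² ≤ (2k₀+j)·h(m+k+l)²  from hc and i(j−i) ≥ 0
    have h1 : (2 * (k₀ : ℝ) + i) * h (m + 2 * (k₀ + i)) ^ 2 ≤ (2 * (k₀ : ℝ) + j) * h (m + (k₀ + i) + (k₀ + j)) ^ 2 := by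
      have hslack : 0 ≤ (i : ℝ) * ((j : ℝ) - i) * h (m + (k₀ + i) + (k₀ + j)) ^ 2 :=
        mul_nonneg (mul_nonneg (Nat.cast_nonneg i) (sub_nonneg.2 hijR)) (sq_nonneg _)
      have h2k : (0 : ℝ) < 2 * ((k₀ : ℝ) + i) := by positivity
      -- hc : 2(k₀+i)·h(m+2(k₀+i))² ≤ (2(k₀+i) + (j−i))·h(m+k+l)²; multiply by (2k₀+i) and compare with 2(k₀+i)·(2k₀+j)
      nlinarith [mul_le_mul_of_nonneg_left hc (show (0 : ℝ) ≤ 2 * (k₀ : ℝ) + i by positivity), sq_nonneg (h (m + (k₀ + i) + (k₀ + j))),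
        sq_nonneg (h (m + 2 * (k₀ + i)))]
    calc (2 * (k₀ : ℝ) + i) * (h (m + 2 * (k₀ + i)) ^ 2 * h (m + 2 * (k₀ + j)) ^ 2)
        = ((2 * (k₀ : ℝ) + i) * h (m + 2 * (k₀ + i)) ^ 2) * h (m + 2 * (k₀ + j)) ^ 2 := by ring
      _ ≤ ((2 * (k₀ : ℝ) + j) * h (m + (k₀ + i) + (k₀ + j)) ^ 2) * h (m + (k₀ + i) + (k₀ + j)) ^ 2 :=
          mul_le_mul h1 ha (sq_nonneg _) (by positivity)
      _ = h (m + (k₀ + i) + (k₀ + j)) ^ 4 * (2 * (k₀ : ℝ) + j) := by ring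
  exact (pow_le_pow_iff_left₀ (by positivity) (hpos _).le (by norm_num : (4 : ℕ) ≠ 0)).mp h4

/-- **LOAD ≤ ADAPTED CHAIN SHARE**: along every flow, for a profile on the ages `< K = k₀ + n`, the position `i < n` (age `k₀+i`), with
`α_j = L_{k₀+j}√(h(m+2(k₀+j)))` and the adapted chain kernel `M_{ij} = Π_{[i,j)}σ·Π_{[j,i)}σ`: `(k₀+i)·L_{k₀+i}h(m+k₀+i)³∕2 ≤ (√2∕2)·α_i∕(Σ_{j<n} M_{ij}α_j)`
((E90b) `load_le_share`, then the window reads dominate `√(h(m+2(k₀+i)))·(Mα)_i` by `chain_kernel_le_from`, the ages `< k₀` dropped). [folklore] -/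
theorem load_le_chain_share_from (hmono : ∀ u v : ℕ → ℝ, SeqBox γ u → SeqBox γ v → (∀ j, u j ≤ v j) → B u ≤ B v)
    (hL : ∀ k, 0 ≤ L k) (hb : 0 < b) (hlo : ∀ u, SeqBox γ u → b ≤ B u) {k₀ n : ℕ} (hk₀ : 1 ≤ k₀)
    (hdom : ∀ u, SeqBox γ u → ∑ k ∈ range (k₀ + n), L k * u k ≤ B u)
    (hh : SeqBox γ h) (hf : MemFlow B gIR h) (m : ℕ) {i : ℕ} (hi : i < n) :
    ((k₀ + i : ℕ) : ℝ) * (L (k₀ + i) * h (m + (k₀ + i)) ^ 3 / 2)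
      ≤ Real.sqrt 2 / 2 * ((L (k₀ + i) * Real.sqrt (h (m + 2 * (k₀ + i))))
          / ∑ j ∈ range n, ((∏ t ∈ Ico i j, Real.sqrt (Real.sqrt ((2 * (k₀ : ℝ) + t) / (2 * (k₀ : ℝ) + t + 1)))) *
              (∏ t ∈ Ico j i, Real.sqrt (Real.sqrt ((2 * (k₀ : ℝ) + t) / (2 * (k₀ : ℝ) + t + 1))))) * (L (k₀ + j) * Real.sqrt (h (m + 2 * (k₀ + j))))) := by
  have hpos : ∀ n, 0 < h n := fun n => (hh n).1
  have hσ0 : ∀ t : ℕ, 0 < Real.sqrt (Real.sqrt ((2 * (k₀ : ℝ) + t) / (2 * (k₀ : ℝ) + t + 1))) := fun t => (sigma_facts hk₀ t).1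
  have hM : ∀ i j : ℕ, 0 < (∏ t ∈ Ico i j, Real.sqrt (Real.sqrt ((2 * (k₀ : ℝ) + t) / (2 * (k₀ : ℝ) + t + 1)))) *
      (∏ t ∈ Ico j i, Real.sqrt (Real.sqrt ((2 * (k₀ : ℝ) + t) / (2 * (k₀ : ℝ) + t + 1)))) := fun i j =>
    mul_pos (prod_pos fun t _ => hσ0 t) (prod_pos fun t _ => hσ0 t)
  have hx := load_le_share hmono hL hb hlo hdom hh hf (show k₀ + i < k₀ + n by omega) m
  refine hx.trans (mul_le_mul_of_nonneg_left ?_ (by positivity))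
  rcases (hL (k₀ + i)).eq_or_lt with hLi | hLi
  · rw [← hLi]; simp
  have hsq := Real.sqrt_pos.2 (hpos (m + 2 * (k₀ + i)))
  have hden : 0 < ∑ j ∈ range n, ((∏ t ∈ Ico i j, Real.sqrt (Real.sqrt ((2 * (k₀ : ℝ) + t) / (2 * (k₀ : ℝ) + t + 1)))) *
      (∏ t ∈ Ico j i, Real.sqrt (Real.sqrt ((2 * (k₀ : ℝ) + t) / (2 * (k₀ : ℝ) + t + 1))))) * (L (k₀ + j) * Real.sqrt (h (m + 2 * (k₀ + j)))) := by
    refine lt_of_lt_of_le ?_ (single_le_sum (f := fun j => ((∏ t ∈ Ico i j, Real.sqrt (Real.sqrt ((2 * (k₀ : ℝ) + t) / (2 * (k₀ : ℝ) + t + 1)))) *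
      (∏ t ∈ Ico j i, Real.sqrt (Real.sqrt ((2 * (k₀ : ℝ) + t) / (2 * (k₀ : ℝ) + t + 1))))) * (L (k₀ + j) * Real.sqrt (h (m + 2 * (k₀ + j)))))
      (fun j _ => mul_nonneg (hM i j).le (mul_nonneg (hL _) (Real.sqrt_nonneg _))) (mem_range.mpr hi))
    exact mul_pos (hM i i) (mul_pos hLi (Real.sqrt_pos.2 (hpos _)))
  have hcmp : Real.sqrt (h (m + 2 * (k₀ + i))) * ∑ j ∈ range n, ((∏ t ∈ Ico i j, Real.sqrt (Real.sqrt ((2 * (k₀ : ℝ) + t) / (2 * (k₀ : ℝ) + t + 1)))) *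
      (∏ t ∈ Ico j i, Real.sqrt (Real.sqrt ((2 * (k₀ : ℝ) + t) / (2 * (k₀ : ℝ) + t + 1))))) * (L (k₀ + j) * Real.sqrt (h (m + 2 * (k₀ + j))))
      ≤ ∑ l ∈ range (k₀ + n), L l * h (m + (k₀ + i) + l) := by
    rw [sum_range_add (fun l => L l * h (m + (k₀ + i) + l)) k₀ n, mul_sum]
    have hhead : 0 ≤ ∑ l ∈ range k₀, L l * h (m + (k₀ + i) + l) := sum_nonneg fun l _ => mul_nonneg (hL l) (hpos _).le
    refine le_trans (sum_le_sum fun j hj => ?_) (le_add_of_nonneg_left hhead)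
    rcases le_total i j with hij | hji
    · rw [Ico_eq_empty_of_le hij, prod_empty, mul_one]
      have hk := chain_kernel_le_from hmono hb hlo hh hf hk₀ m hij
      have := mul_le_mul_of_nonneg_left hk (hL (k₀ + j))
      nlinarith [this]
    · rw [Ico_eq_empty_of_le hji, prod_empty, one_mul]
      have hk := chain_kernel_le_from hmono hb hlo hh hf hk₀ m hji
      rw [show m + (k₀ + j) + (k₀ + i) = m + (k₀ + i) + (k₀ + j) by ring] at hk
      have := mul_le_mul_of_nonneg_left hk (hL (k₀ + j))
      nlinarith [this]
  calc L (k₀ + i) * h (m + 2 * (k₀ + i)) / ∑ l ∈ range (k₀ + n), L l * h (m + (k₀ + i) + l)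
      ≤ L (k₀ + i) * h (m + 2 * (k₀ + i)) / (Real.sqrt (h (m + 2 * (k₀ + i))) * ∑ j ∈ range n,
          ((∏ t ∈ Ico i j, Real.sqrt (Real.sqrt ((2 * (k₀ : ℝ) + t) / (2 * (k₀ : ℝ) + t + 1)))) *
            (∏ t ∈ Ico j i, Real.sqrt (Real.sqrt ((2 * (k₀ : ℝ) + t) / (2 * (k₀ : ℝ) + t + 1))))) * (L (k₀ + j) * Real.sqrt (h (m + 2 * (k₀ + j))))) :=
        div_le_div_of_nonneg_left (mul_nonneg (hL _) (hpos _).le) (mul_pos hsq hden) hcmp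
    _ = L (k₀ + i) * Real.sqrt (h (m + 2 * (k₀ + i))) / ∑ j ∈ range n,
          ((∏ t ∈ Ico i j, Real.sqrt (Real.sqrt ((2 * (k₀ : ℝ) + t) / (2 * (k₀ : ℝ) + t + 1)))) *
            (∏ t ∈ Ico j i, Real.sqrt (Real.sqrt ((2 * (k₀ : ℝ) + t) / (2 * (k₀ : ℝ) + t + 1))))) * (L (k₀ + j) * Real.sqrt (h (m + 2 * (k₀ + j)))) := by
        rw [div_eq_div_iff (mul_pos hsq hden).ne' hden.ne']
        have e : Real.sqrt (h (m + 2 * (k₀ + i))) * Real.sqrt (h (m + 2 * (k₀ + i))) = h (m + 2 * (k₀ + i)) := Real.mul_self_sqrt (hpos _).le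
        calc L (k₀ + i) * h (m + 2 * (k₀ + i)) * ∑ j ∈ range n,
              ((∏ t ∈ Ico i j, Real.sqrt (Real.sqrt ((2 * (k₀ : ℝ) + t) / (2 * (k₀ : ℝ) + t + 1)))) *
                (∏ t ∈ Ico j i, Real.sqrt (Real.sqrt ((2 * (k₀ : ℝ) + t) / (2 * (k₀ : ℝ) + t + 1))))) * (L (k₀ + j) * Real.sqrt (h (m + 2 * (k₀ + j))))
            = L (k₀ + i) * (Real.sqrt (h (m + 2 * (k₀ + i))) * Real.sqrt (h (m + 2 * (k₀ + i)))) * ∑ j ∈ range n,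
              ((∏ t ∈ Ico i j, Real.sqrt (Real.sqrt ((2 * (k₀ : ℝ) + t) / (2 * (k₀ : ℝ) + t + 1)))) *
                (∏ t ∈ Ico j i, Real.sqrt (Real.sqrt ((2 * (k₀ : ℝ) + t) / (2 * (k₀ : ℝ) + t + 1))))) * (L (k₀ + j) * Real.sqrt (h (m + 2 * (k₀ + j)))) := by rw [e]
          _ = _ := by ring

/-- **ROUTE (N), FIRST ORDER — THE SCALE-FREE MASS THEOREM: EVERY PROFILE INSIDE AN AGE WINDOW `[k₀, 53·k₀]`.**  `B` an isotone memory on the box with floor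
`b > 0` dominating the profile `L ≥ 0` on the ages `< K`, where `L_k = 0` for `k < k₀`, `k₀ ≥ 1` and `K ≤ 53·k₀ + 1` (so every loaded age lies in
`[k₀, 53·k₀]`) — NO restriction on the number of loaded ages or on how the load is distributed among them; `h` a box solution from any pin.  Then
`Σ_{k<K} k·L_kh(m+k)³∕2 ≤ 1` at every pin `m`: loads `≤ (√2∕2)·`shares ((E90b)), shares dominated by the adapted chain (`load_le_chain_share_from`), chain sum
`≤ 1 + ⅛·log((k₀+K−1)∕(2k₀)) ≤ 1 + ⅛·log 27 ≤ √2` (`chain_shares_le`, `sum_defect_le_log`, `chain_const_le_sqrt_two`). [folklore] -/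
theorem total_load_le_one_of_age_ratio (hmono : ∀ u v : ℕ → ℝ, SeqBox γ u → SeqBox γ v → (∀ j, u j ≤ v j) → B u ≤ B v)
    (hL : ∀ k, 0 ≤ L k) (hb : 0 < b) (hlo : ∀ u, SeqBox γ u → b ≤ B u) (hdom : ∀ u, SeqBox γ u → ∑ k ∈ range K, L k * u k ≤ B u)
    (hh : SeqBox γ h) (hf : MemFlow B gIR h) {k₀ : ℕ} (hk₀ : 1 ≤ k₀) (hsupp : ∀ k, k < k₀ → L k = 0) (hK : K ≤ 53 * k₀ + 1) (m : ℕ) :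
    ∑ k ∈ range K, (k : ℝ) * (L k * h (m + k) ^ 3 / 2) ≤ 1 := by
  have hpos : ∀ n, 0 < h n := fun n => (hh n).1
  have hk : (1 : ℝ) ≤ k₀ := by exact_mod_cast hk₀
  by_cases hKk : K ≤ k₀
  · -- every age below k₀: all loads vanish
    rw [sum_eq_zero fun k hk' => by rw [hsupp k (lt_of_lt_of_le (mem_range.mp hk') hKk)]; simp]
    norm_num
  obtain ⟨n, rfl⟩ : ∃ n, K = k₀ + (n + 1) := ⟨K - k₀ - 1, by omega⟩
  -- split off the (empty) ages below k₀
  rw [sum_range_add, sum_eq_zero fun k hk' => by rw [hsupp k (mem_range.mp hk')]; simp, zero_add]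
  have hσ0 : ∀ t : ℕ, 0 < Real.sqrt (Real.sqrt ((2 * (k₀ : ℝ) + t) / (2 * (k₀ : ℝ) + t + 1))) := fun t => (sigma_facts hk₀ t).1
  have hσ1 : ∀ t : ℕ, Real.sqrt (Real.sqrt ((2 * (k₀ : ℝ) + t) / (2 * (k₀ : ℝ) + t + 1))) < 1 := fun t => (sigma_facts hk₀ t).2.1
  have hα0 : ∀ j, 0 ≤ L (k₀ + j) * Real.sqrt (h (m + 2 * (k₀ + j))) := fun j => mul_nonneg (hL _) (Real.sqrt_nonneg _)
  by_cases hz : ∑ j ∈ range (n + 1), L (k₀ + j) * Real.sqrt (h (m + 2 * (k₀ + j))) = 0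
  · have hall : ∀ j ∈ range (n + 1), L (k₀ + j) * Real.sqrt (h (m + 2 * (k₀ + j))) = 0 := (sum_eq_zero_iff_of_nonneg fun j _ => hα0 j).mp hz
    have hL0 : ∀ j ∈ range (n + 1), L (k₀ + j) = 0 := fun j hj => by
      rcases mul_eq_zero.mp (hall j hj) with h0 | h0
      · exact h0
      · exact absurd h0 (Real.sqrt_pos.2 (hpos _)).ne'
    rw [sum_eq_zero fun j hj => by rw [hL0 j hj]; simp]
    norm_num
  have hαpos : 0 < ∑ j ∈ range (n + 1), L (k₀ + j) * Real.sqrt (h (m + 2 * (k₀ + j))) :=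
    lt_of_le_of_ne (sum_nonneg fun j _ => hα0 j) (Ne.symm hz)
  have hchain := chain_shares_le hσ0 hσ1 n (fun j => L (k₀ + j) * Real.sqrt (h (m + 2 * (k₀ + j)))) hα0 hαpos
  have htel := sum_defect_le_log hk₀ n
  -- the chain constant: (2k₀+n)∕(2k₀) ≤ 27 since k₀ + n + 1 = K ≤ 53k₀ + 1
  have hratio : (2 * (k₀ : ℝ) + n) / (2 * (k₀ : ℝ)) ≤ 27 := by
    rw [div_le_iff₀ (by positivity)]
    have : ((k₀ + (n + 1) : ℕ) : ℝ) ≤ ((53 * k₀ + 1 : ℕ) : ℝ) := by exact_mod_cast hK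
    push_cast at this
    linarith
  have hconst := chain_const_le_sqrt_two (show (0 : ℝ) < (2 * (k₀ : ℝ) + n) / (2 * (k₀ : ℝ)) by positivity) hratio
  rw [Real.log_div (by positivity) (by positivity)] at hconst
  have hterms := sum_le_sum fun i hi => load_le_chain_share_from hmono hL hb hlo hk₀ hdom hh hf m (mem_range.mp hi : i < n + 1)
  rw [← mul_sum] at hterms
  have hs2 : Real.sqrt 2 / 2 * Real.sqrt 2 = 1 := by
    rw [div_mul_eq_mul_div, Real.mul_self_sqrt (by norm_num)]; norm_num
  calc ∑ i ∈ range (n + 1), (((k₀ + i : ℕ) : ℝ)) * (L (k₀ + i) * h (m + (k₀ + i)) ^ 3 / 2)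
      ≤ Real.sqrt 2 / 2 * ∑ i ∈ range (n + 1), (L (k₀ + i) * Real.sqrt (h (m + 2 * (k₀ + i))))
          / ∑ j ∈ range (n + 1), ((∏ t ∈ Ico i j, Real.sqrt (Real.sqrt ((2 * (k₀ : ℝ) + t) / (2 * (k₀ : ℝ) + t + 1)))) *
              (∏ t ∈ Ico j i, Real.sqrt (Real.sqrt ((2 * (k₀ : ℝ) + t) / (2 * (k₀ : ℝ) + t + 1))))) * (L (k₀ + j) * Real.sqrt (h (m + 2 * (k₀ + j)))) := hterms
    _ ≤ Real.sqrt 2 / 2 * Real.sqrt 2 := mul_le_mul_of_nonneg_left (hchain.trans (by linarith)) (by positivity)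
    _ = 1 := hs2

/-- **THE END FOR EVERY PROFILE INSIDE AN AGE WINDOW `[k₀, 53·k₀]`, ALONG EVERY FLOW, ANY DAMPING, ANY HORIZON** ((E89b) `flow_nonneg_of_window_loads_le_one` with
its hypothesis on the total window load DISCHARGED by `total_load_le_one_of_age_ratio`): `1 ≤ K`, `L_k = 0` below `k₀ ≥ 1`, `K ≤ 53·k₀ + 1`, the memory
isotone with floor `b > 0` dominating `L ≥ 0`, `h` a box solution, `0 < g ≤ 1`; then `0 ≤ ε m ≤ e m` at every pin for every admissible excess. [folklore] -/
theorem flow_nonneg_of_age_ratio (hmono : ∀ u v : ℕ → ℝ, SeqBox γ u → SeqBox γ v → (∀ j, u j ≤ v j) → B u ≤ B v)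
    (hL : ∀ k, 0 ≤ L k) (hb : 0 < b) (hlo : ∀ u, SeqBox γ u → b ≤ B u) (hdom : ∀ u, SeqBox γ u → ∑ k ∈ range K, L k * u k ≤ B u)
    (hh : SeqBox γ h) (hf : MemFlow B gIR h) (hg : ∀ t, 0 < g t ∧ g t ≤ 1) (hK1 : 1 ≤ K) {k₀ : ℕ} (hk₀ : 1 ≤ k₀)
    (hsupp : ∀ k, k < k₀ → L k = 0) (hK : K ≤ 53 * k₀ + 1) {N : ℕ} (hKN : K ≤ N)
    {KL : ℕ → ℕ → ℕ → ℝ}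
    (hKL : ∀ k n l, KL k n l = if 0 < k ∧ k < K ∧ l < k then L k * h (n + k) ^ 3 / 2 * ∏ t ∈ Ico (n + 1 + l) (n + k + 1), g t else 0)
    {KA : ℕ → ℕ → ℕ → ℝ} {RA : ℕ → (ℕ → ℝ) → ℕ → ℝ}
    (hRA : ∀ i v m, RA i v m = ∑ l ∈ range K, KA i m l * v (m + 1 + l))
    (hKA : ∀ i m l, KA i m l = KL i m l + KA (i + 1) m l) (hKAtop : ∀ m l, KA K m l = 0)
    {e ε : ℕ → ℝ} (he0 : ∀ m, 0 ≤ e m) (hea : ∀ m, e (m + 1) ≤ e m)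
    (hεt : ∀ m, N < m → ε m = 0) (hεrec : ∀ m, ε m = e m - RA 1 ε m) : ∀ m, 0 ≤ ε m ∧ ε m ≤ e m :=
  flow_nonneg_of_window_loads_le_one hL hh hg hK1 hKN hKL hRA hKA hKAtop
    (fun m => total_load_le_one_of_age_ratio hmono hL hb hlo hdom hh hf hk₀ hsupp hK m) he0 hea hεt hεrec

end Summit.QuantumFields.BalabanUV.Beta.EriceRemainderEnclosureHistoryAutonomyComparisonAgeCompositionAgeRatioWindow

end
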